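import Mathlib
import Summits.Ventures.PercRepro2.Defs
import Summits.Ventures.PercRepro2.Independence
import Summits.Ventures.PercRepro2.Harris
import Summits.Ventures.PercRepro2.Graph
import Summits.Ventures.PercRepro2.Events
import Summits.Ventures.PercRepro2.R21PinInduction
import Summits.Ventures.PercRepro2.R21TFrame
import Summits.Ventures.PercRepro2.R21BernAll
import Summits.Ventures.PercRepro2.R21NestedFrame

/-!
# The termwise antipodal frame at the explored `o`-component: (R2-1) ⟸ (TOP-TERM) (PercRepro2, p2)

For a set `F` of unpinned edges at `Λ_o` and `η ⊆ F`, the **complementary-pinning term**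
`τ_{F,η}(p) := T(pinOn p F 1_η, pinOn p F 1_{F∖η})` (the symmetric bilinear form `T` of the two instances
pinned in complementary ways on `F`; `τ_{∅,∅} = 2R`, `τ_{{g},∅} = T_g`).  Census (P2-G21-SINGLEEDGE.md
§7): `τ_{F,η} ≥ 0` for every `F ⊆ edges at Λ_o` and every `η` (0 / 1,318 at `n ≤ 6`, `|F| ≤ 3`), while
off `Λ_o` the terms fail often (190 / 3,650) — the antipodal structure is TERMWISE positive at the
explored `o`-component.  Along an edge `e ∉ F` at `Λ_o` each term expands (`r21_term_eq_bernstein`)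
into the same term at the two pins of `e` (fewer unpinned edges) and the two terms of `F ∪ {e}`
(`η` and `η ∪ {e}`) at the same `p` — so by a downward induction on `|U(p) ∖ F|` inside a strong pin
induction, everything reduces to the TOP terms `F = U(p)` (all unpinned edges at `Λ_o` pinned
complementarily — the explored instances with `Λ_o` a pendant blob glued to complementary sets of
far ends):

  **(TOP-TERM)**  `0 ≤ τ_{U(p),η}(p)` for every admissible `p`, every mark assignment, every `η ⊆ U(p)`.

`r21_of_top_term`: **(R2-1) for every weight vector and every mark assignment ⟸ (TOP-TERM)**.  The
single-edge theorem `r21_T_nonneg_of_single_edge` is the case `|U(p)| = 1` of (TOP-TERM) (modulo the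
re-marked induction hypothesis), and for `|U(p)| = 2` the two terms are `½(R(o↦z₁) + R(o↦z₂))` (the
incomparable pair) and `X/2` (record §7.2).

* the `pinOn` lemmas — pinning a finite edge set to a point configuration (`pinOn` of R21BernAll.lean);
* `r21_term_eq_bernstein` — the Bernstein form of a term along `e ∉ F`;
* `r21_of_top_term` — **the frame**.
-/

namespace Summit.Ventures.PercRepro2

section TermFrame

variable {V : Type*} {E : Type*} [Fintype E] [DecidableEq E]
  {R : Type*} [CommRing R] [LinearOrder R] [IsStrictOrderedRing R]


omit [Fintype E] [IsStrictOrderedRing R] [LinearOrder R] in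
/-- Two point configurations agreeing on `F` give the same pinning. -/
lemma pinOn_congr_on (p : E → R) (F : Finset E) {η₁ η₂ : E → Bool} (h : ∀ e ∈ F, η₁ e = η₂ e) :
    pinOn p F η₁ = pinOn p F η₂ := by
  funext e
  by_cases he : e ∈ F
  · simp [pinOn, he, h e he]
  · simp [pinOn, he]

omit [Fintype E] [IsStrictOrderedRing R] [LinearOrder R] in
/-- Adjoining an edge `e ∉ F` to `F` with `e ∉ η` pins it closed: the set pinning of `p[e↦0]`. -/
lemma pinOn_insert_mem_zero (p : E → R) (F η : Finset E) {e : E} (he : e ∉ F) (heη : e ∉ η) :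
    pinOn p (insert e F) (fun e' => decide (e' ∈ η)) =
      pinOn (Function.update p e 0) F (fun e' => decide (e' ∈ η)) := by
  rw [pinOn_insert, pinOn_update_of_notMem p F _ he]
  simp [heη]

omit [Fintype E] [IsStrictOrderedRing R] [LinearOrder R] in
/-- Adjoining `e ∉ F` to `F` and to `η` pins it open: the set pinning of `p[e↦1]`. -/
lemma pinOn_insert_mem_one (p : E → R) (F η : Finset E) {e : E} (he : e ∉ F) :
    pinOn p (insert e F) (fun e' => decide (e' ∈ insert e η)) =
      pinOn (Function.update p e 1) F (fun e' => decide (e' ∈ η)) := by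
  rw [pinOn_insert, pinOn_update_of_notMem p F _ he]
  simp only [Finset.mem_insert, true_or, decide_true, if_true]
  congr 1
  refine pinOn_congr_on p F fun e' he' => ?_
  have : e' ≠ e := fun h => he (h ▸ he')
  simp [this]

omit [Fintype E] [IsStrictOrderedRing R] [LinearOrder R] in
/-- The complementary pinning on `insert e F` with `e ∉ η` pins `e` open. -/
lemma pinOn_insert_notMem_one (p : E → R) (F η : Finset E) {e : E} (he : e ∉ F) (heη : e ∉ η) :
    pinOn p (insert e F) (fun e' => decide (e' ∉ η)) =
      pinOn (Function.update p e 1) F (fun e' => decide (e' ∉ η)) := by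
  rw [pinOn_insert, pinOn_update_of_notMem p F _ he]
  simp [heη]

omit [Fintype E] [IsStrictOrderedRing R] [LinearOrder R] in
/-- The complementary pinning on `insert e F` with `e` adjoined to `η` pins `e` closed. -/
lemma pinOn_insert_notMem_zero (p : E → R) (F η : Finset E) {e : E} (he : e ∉ F) :
    pinOn p (insert e F) (fun e' => decide (e' ∉ insert e η)) =
      pinOn (Function.update p e 0) F (fun e' => decide (e' ∉ η)) := by
  rw [pinOn_insert, pinOn_update_of_notMem p F _ he]
  simp only [Finset.mem_insert, true_or, not_true_eq_false, decide_false]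
  congr 1
  refine pinOn_congr_on p F fun e' he' => ?_
  have : e' ≠ e := fun h => he (h ▸ he')
  simp [this]

omit [Fintype E] [IsStrictOrderedRing R] [LinearOrder R] in
/-- Pinning nothing is the identity. -/
lemma pinOn_empty' (p : E → R) (η : E → Bool) : pinOn p ∅ η = p := by
  funext e; simp [pinOn]

omit [LinearOrder R] [IsStrictOrderedRing R] in
/-- **The Bernstein form of a complementary-pinning term along an edge `e ∉ F`.** -/
lemma r21_term_eq_bernstein (p : E → R) (ends : E → Sym2 V) (s y o u : V) (F η : Finset E) (e : E) (he : e ∉ F) :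
    (prob (pinOn p F (fun e' => decide (e' ∈ η))) (connEvent ends s u ∩ clusterInEvent ends s {W : Set V | o ∈ W} ∩ (connEvent ends s y)ᶜ) + prob (pinOn p F (fun e' => decide (e' ∉ η))) (connEvent ends s u ∩ clusterInEvent ends s {W : Set V | o ∈ W} ∩ (connEvent ends s y)ᶜ) + prob (pinOn p F (fun e' => decide (e' ∈ η))) (connEvent ends s u ∩ connEvent ends y o ∩ (connEvent ends s y)ᶜ) + prob (pinOn p F (fun e' => decide (e' ∉ η))) (connEvent ends s u ∩ connEvent ends y o ∩ (connEvent ends s y)ᶜ) + prob (pinOn p F (fun e' => decide (e' ∈ η))) ((connEvent ends s y)ᶜ) * prob (pinOn p F (fun e' => decide (e' ∉ η))) (connEvent ends s u ∩ clusterInEvent ends s {W : Set V | o ∈ W}) + prob (pinOn p F (fun e' => decide (e' ∉ η))) ((connEvent ends s y)ᶜ) * prob (pinOn p F (fun e' => decide (e' ∈ η))) (connEvent ends s u ∩ clusterInEvent ends s {W : Set V | o ∈ W}) - (prob (pinOn p F (fun e' => decide (e' ∈ η))) (connEvent ends s u ∩ (connEvent ends s y)ᶜ) * prob (pinOn p F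 (fun e' => decide (e' ∉ η))) (clusterInEvent ends s {W : Set V | o ∈ W}) + prob (pinOn p F (fun e' => decide (e' ∉ η))) (connEvent ends s u ∩ (connEvent ends s y)ᶜ) * prob (pinOn p F (fun e' => decide (e' ∈ η))) (clusterInEvent ends s {W : Set V | o ∈ W}) + prob (pinOn p F (fun e' => decide (e' ∈ η))) (clusterInEvent ends s {W : Set V | o ∈ W} ∩ (connEvent ends s y)ᶜ) * prob (pinOn p F (fun e' => decide (e' ∉ η))) (connEvent ends s u) + prob (pinOn p F (fun e' => decide (e' ∉ η))) (clusterInEvent ends s {W : Set V | o ∈ W} ∩ (connEvent ends s y)ᶜ) * prob (pinOn p F (fun e' => decide (e' ∈ η))) (connEvent ends s u) + prob (pinOn p F (fun e' => decide (e' ∈ η))) (connEvent ends y o ∩ (connEvent ends s y)ᶜ) * prob (pinOn p F (fun e' => decide (e' ∉ η))) (connEvent ends s u) + prob (pinOn p F (fun e' => decide (e' ∉ η))) (connEvent ends y o ∩ (connEvent ends s y)ᶜ) * prob (pinOn p F (fun e' => decide (e' ∈ η))) (connEvent ends s u))) =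
      (1 - p e) ^ 2 * (prob (pinOn (Function.update p e 0) F (fun e' => decide (e' ∈ η))) (connEvent ends s u ∩ clusterInEvent ends s {W : Set V | o ∈ W} ∩ (connEvent ends s y)ᶜ) + prob (pinOn (Function.update p e 0) F (fun e' => decide (e' ∉ η))) (connEvent ends s u ∩ clusterInEvent ends s {W : Set V | o ∈ W} ∩ (connEvent ends s y)ᶜ) + prob (pinOn (Function.update p e 0) F (fun e' => decide (e' ∈ η))) (connEvent ends s u ∩ connEvent ends y o ∩ (connEvent ends s y)ᶜ) + prob (pinOn (Function.update p e 0) F (fun e' => decide (e' ∉ η))) (connEvent ends s u ∩ connEvent ends y o ∩ (connEvent ends s y)ᶜ) + prob (pinOn (Function.update p e 0) F (fun e' => decide (e' ∈ η))) ((connEvent ends s y)ᶜ) * prob (pinOn (Function.update p e 0) F (fun e' => decide (e' ∉ η))) (connEvent ends s u ∩ clusterInEvent ends s {W : Set V | o ∈ W}) + prob (pinOn (Function.update p e 0) F (fun e' => decide (e' ∉ η))) ((connEvent ends s y)ᶜ) * prob (pinOn (Function.update p e 0) F (fun e' => decide (e' ∈ η))) (connEvent ends s u ∩ clusterInEvent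 ends s {W : Set V | o ∈ W}) - (prob (pinOn (Function.update p e 0) F (fun e' => decide (e' ∈ η))) (connEvent ends s u ∩ (connEvent ends s y)ᶜ) * prob (pinOn (Function.update p e 0) F (fun e' => decide (e' ∉ η))) (clusterInEvent ends s {W : Set V | o ∈ W}) + prob (pinOn (Function.update p e 0) F (fun e' => decide (e' ∉ η))) (connEvent ends s u ∩ (connEvent ends s y)ᶜ) * prob (pinOn (Function.update p e 0) F (fun e' => decide (e' ∈ η))) (clusterInEvent ends s {W : Set V | o ∈ W}) + prob (pinOn (Function.update p e 0) F (fun e' => decide (e' ∈ η))) (clusterInEvent ends s {W : Set V | o ∈ W} ∩ (connEvent ends s y)ᶜ) * prob (pinOn (Function.update p e 0) F (fun e' => decide (e' ∉ η))) (connEvent ends s u) + prob (pinOn (Function.update p e 0) F (fun e' => decide (e' ∉ η))) (clusterInEvent ends s {W : Set V | o ∈ W} ∩ (connEvent ends s y)ᶜ) * prob (pinOn (Function.update p e 0) F (fun e' => decide (e' ∈ η))) (connEvent ends s u) + prob (pinOn (Function.update p e 0) F (fun e' => decide (e' ∈ η))) (connEvent ends y o ∩ (connEvent ends s y)ᶜ)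 * prob (pinOn (Function.update p e 0) F (fun e' => decide (e' ∉ η))) (connEvent ends s u) + prob (pinOn (Function.update p e 0) F (fun e' => decide (e' ∉ η))) (connEvent ends y o ∩ (connEvent ends s y)ᶜ) * prob (pinOn (Function.update p e 0) F (fun e' => decide (e' ∈ η))) (connEvent ends s u))) +
        p e * (1 - p e) * ((prob (pinOn (Function.update p e 0) F (fun e' => decide (e' ∈ η))) (connEvent ends s u ∩ clusterInEvent ends s {W : Set V | o ∈ W} ∩ (connEvent ends s y)ᶜ) + prob (pinOn (Function.update p e 1) F (fun e' => decide (e' ∉ η))) (connEvent ends s u ∩ clusterInEvent ends s {W : Set V | o ∈ W} ∩ (connEvent ends s y)ᶜ) + prob (pinOn (Function.update p e 0) F (fun e' => decide (e' ∈ η))) (connEvent ends s u ∩ connEvent ends y o ∩ (connEvent ends s y)ᶜ) + prob (pinOn (Function.update p e 1) F (fun e' => decide (e' ∉ η))) (connEvent ends s u ∩ connEvent ends y o ∩ (connEvent ends s y)ᶜ) + prob (pinOn (Function.update p e 0) F (fun e' => decide (e' ∈ η))) ((connEvent ends s y)ᶜ) * prob (pinOn (Function.update p e 1) F (fun e' =>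 decide (e' ∉ η))) (connEvent ends s u ∩ clusterInEvent ends s {W : Set V | o ∈ W}) + prob (pinOn (Function.update p e 1) F (fun e' => decide (e' ∉ η))) ((connEvent ends s y)ᶜ) * prob (pinOn (Function.update p e 0) F (fun e' => decide (e' ∈ η))) (connEvent ends s u ∩ clusterInEvent ends s {W : Set V | o ∈ W}) - (prob (pinOn (Function.update p e 0) F (fun e' => decide (e' ∈ η))) (connEvent ends s u ∩ (connEvent ends s y)ᶜ) * prob (pinOn (Function.update p e 1) F (fun e' => decide (e' ∉ η))) (clusterInEvent ends s {W : Set V | o ∈ W}) + prob (pinOn (Function.update p e 1) F (fun e' => decide (e' ∉ η))) (connEvent ends s u ∩ (connEvent ends s y)ᶜ) * prob (pinOn (Function.update p e 0) F (fun e' => decide (e' ∈ η))) (clusterInEvent ends s {W : Set V | o ∈ W}) + prob (pinOn (Function.update p e 0) F (fun e' => decide (e' ∈ η))) (clusterInEvent ends s {W : Set V | o ∈ W} ∩ (connEvent ends s y)ᶜ) * prob (pinOn (Function.update p e 1) F (fun e' => decide (e' ∉ η))) (connEvent ends s u) + prob (pinOn (Function.update p e 1) F (fun e' => decide (e' ∉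 η))) (clusterInEvent ends s {W : Set V | o ∈ W} ∩ (connEvent ends s y)ᶜ) * prob (pinOn (Function.update p e 0) F (fun e' => decide (e' ∈ η))) (connEvent ends s u) + prob (pinOn (Function.update p e 0) F (fun e' => decide (e' ∈ η))) (connEvent ends y o ∩ (connEvent ends s y)ᶜ) * prob (pinOn (Function.update p e 1) F (fun e' => decide (e' ∉ η))) (connEvent ends s u) + prob (pinOn (Function.update p e 1) F (fun e' => decide (e' ∉ η))) (connEvent ends y o ∩ (connEvent ends s y)ᶜ) * prob (pinOn (Function.update p e 0) F (fun e' => decide (e' ∈ η))) (connEvent ends s u))) + (prob (pinOn (Function.update p e 1) F (fun e' => decide (e' ∈ η))) (connEvent ends s u ∩ clusterInEvent ends s {W : Set V | o ∈ W} ∩ (connEvent ends s y)ᶜ) + prob (pinOn (Function.update p e 0) F (fun e' => decide (e' ∉ η))) (connEvent ends s u ∩ clusterInEvent ends s {W : Set V | o ∈ W} ∩ (connEvent ends s y)ᶜ) + prob (pinOn (Function.update p e 1) F (fun e' => decide (e' ∈ η))) (connEvent ends s u ∩ connEvent ends y o ∩ (connEvent ends s y)ᶜ) + prob (pinOn (Function.update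 p e 0) F (fun e' => decide (e' ∉ η))) (connEvent ends s u ∩ connEvent ends y o ∩ (connEvent ends s y)ᶜ) + prob (pinOn (Function.update p e 1) F (fun e' => decide (e' ∈ η))) ((connEvent ends s y)ᶜ) * prob (pinOn (Function.update p e 0) F (fun e' => decide (e' ∉ η))) (connEvent ends s u ∩ clusterInEvent ends s {W : Set V | o ∈ W}) + prob (pinOn (Function.update p e 0) F (fun e' => decide (e' ∉ η))) ((connEvent ends s y)ᶜ) * prob (pinOn (Function.update p e 1) F (fun e' => decide (e' ∈ η))) (connEvent ends s u ∩ clusterInEvent ends s {W : Set V | o ∈ W}) - (prob (pinOn (Function.update p e 1) F (fun e' => decide (e' ∈ η))) (connEvent ends s u ∩ (connEvent ends s y)ᶜ) * prob (pinOn (Function.update p e 0) F (fun e' => decide (e' ∉ η))) (clusterInEvent ends s {W : Set V | o ∈ W}) + prob (pinOn (Function.update p e 0) F (fun e' => decide (e' ∉ η))) (connEvent ends s u ∩ (connEvent ends s y)ᶜ) * prob (pinOn (Function.update p e 1) F (fun e' => decide (e' ∈ η))) (clusterInEvent ends s {W : Set V | o ∈ W}) + prob (pinOn (Function.update p e 1)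 F (fun e' => decide (e' ∈ η))) (clusterInEvent ends s {W : Set V | o ∈ W} ∩ (connEvent ends s y)ᶜ) * prob (pinOn (Function.update p e 0) F (fun e' => decide (e' ∉ η))) (connEvent ends s u) + prob (pinOn (Function.update p e 0) F (fun e' => decide (e' ∉ η))) (clusterInEvent ends s {W : Set V | o ∈ W} ∩ (connEvent ends s y)ᶜ) * prob (pinOn (Function.update p e 1) F (fun e' => decide (e' ∈ η))) (connEvent ends s u) + prob (pinOn (Function.update p e 1) F (fun e' => decide (e' ∈ η))) (connEvent ends y o ∩ (connEvent ends s y)ᶜ) * prob (pinOn (Function.update p e 0) F (fun e' => decide (e' ∉ η))) (connEvent ends s u) + prob (pinOn (Function.update p e 0) F (fun e' => decide (e' ∉ η))) (connEvent ends y o ∩ (connEvent ends s y)ᶜ) * prob (pinOn (Function.update p e 1) F (fun e' => decide (e' ∈ η))) (connEvent ends s u)))) +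
        p e ^ 2 * (prob (pinOn (Function.update p e 1) F (fun e' => decide (e' ∈ η))) (connEvent ends s u ∩ clusterInEvent ends s {W : Set V | o ∈ W} ∩ (connEvent ends s y)ᶜ) + prob (pinOn (Function.update p e 1) F (fun e' => decide (e' ∉ η))) (connEvent ends s u ∩ clusterInEvent ends s {W : Set V | o ∈ W} ∩ (connEvent ends s y)ᶜ) + prob (pinOn (Function.update p e 1) F (fun e' => decide (e' ∈ η))) (connEvent ends s u ∩ connEvent ends y o ∩ (connEvent ends s y)ᶜ) + prob (pinOn (Function.update p e 1) F (fun e' => decide (e' ∉ η))) (connEvent ends s u ∩ connEvent ends y o ∩ (connEvent ends s y)ᶜ) + prob (pinOn (Function.update p e 1) F (fun e' => decide (e' ∈ η))) ((connEvent ends s y)ᶜ) * prob (pinOn (Function.update p e 1) F (fun e' => decide (e' ∉ η))) (connEvent ends s u ∩ clusterInEvent ends s {W : Set V | o ∈ W}) + prob (pinOn (Function.update p e 1) F (fun e' => decide (e' ∉ η))) ((connEvent ends s y)ᶜ) * prob (pinOn (Function.update p e 1) F (fun e' => decide (e' ∈ η))) (connEvent ends s u ∩ clusterInEvent ends s {W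 : Set V | o ∈ W}) - (prob (pinOn (Function.update p e 1) F (fun e' => decide (e' ∈ η))) (connEvent ends s u ∩ (connEvent ends s y)ᶜ) * prob (pinOn (Function.update p e 1) F (fun e' => decide (e' ∉ η))) (clusterInEvent ends s {W : Set V | o ∈ W}) + prob (pinOn (Function.update p e 1) F (fun e' => decide (e' ∉ η))) (connEvent ends s u ∩ (connEvent ends s y)ᶜ) * prob (pinOn (Function.update p e 1) F (fun e' => decide (e' ∈ η))) (clusterInEvent ends s {W : Set V | o ∈ W}) + prob (pinOn (Function.update p e 1) F (fun e' => decide (e' ∈ η))) (clusterInEvent ends s {W : Set V | o ∈ W} ∩ (connEvent ends s y)ᶜ) * prob (pinOn (Function.update p e 1) F (fun e' => decide (e' ∉ η))) (connEvent ends s u) + prob (pinOn (Function.update p e 1) F (fun e' => decide (e' ∉ η))) (clusterInEvent ends s {W : Set V | o ∈ W} ∩ (connEvent ends s y)ᶜ) * prob (pinOn (Function.update p e 1) F (fun e' => decide (e' ∈ η))) (connEvent ends s u) + prob (pinOn (Function.update p e 1) F (fun e' => decide (e' ∈ η))) (connEvent ends y o ∩ (connEvent ends s y)ᶜ) * prob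 (pinOn (Function.update p e 1) F (fun e' => decide (e' ∉ η))) (connEvent ends s u) + prob (pinOn (Function.update p e 1) F (fun e' => decide (e' ∉ η))) (connEvent ends y o ∩ (connEvent ends s y)ᶜ) * prob (pinOn (Function.update p e 1) F (fun e' => decide (e' ∈ η))) (connEvent ends s u))) := by
  have hw : pinOn p F (fun e' => decide (e' ∈ η)) e = p e := pinOn_apply_of_notMem p F _ he
  have hw' : pinOn p F (fun e' => decide (e' ∉ η)) e = p e := pinOn_apply_of_notMem p F _ he
  simp only [prob_eq_pin (pinOn p F (fun e' => decide (e' ∈ η))) _ e, prob_eq_pin (pinOn p F (fun e' => decide (e' ∉ η))) _ e, hw, hw',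
    ← pinOn_update_of_notMem p F _ he]
  have h := r21_T_bernstein_algebra (p e)
    (prob (pinOn (Function.update p e 0) F (fun e' => decide (e' ∈ η))) (connEvent ends s u ∩ clusterInEvent ends s {W : Set V | o ∈ W} ∩ (connEvent ends s y)ᶜ))
    (prob (pinOn (Function.update p e 0) F (fun e' => decide (e' ∈ η))) (connEvent ends s u ∩ connEvent ends y o ∩ (connEvent ends s y)ᶜ))
    (prob (pinOn (Function.update p e 0) F (fun e' => decide (e' ∈ η))) ((connEvent ends s y)ᶜ))
    (prob (pinOn (Function.update p e 0) F (fun e' => decide (e' ∈ η))) (connEvent ends s u ∩ clusterInEvent ends s {W : Set V | o ∈ W}))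
    (prob (pinOn (Function.update p e 0) F (fun e' => decide (e' ∈ η))) (connEvent ends s u ∩ (connEvent ends s y)ᶜ))
    (prob (pinOn (Function.update p e 0) F (fun e' => decide (e' ∈ η))) (clusterInEvent ends s {W : Set V | o ∈ W}))
    (prob (pinOn (Function.update p e 0) F (fun e' => decide (e' ∈ η))) (clusterInEvent ends s {W : Set V | o ∈ W} ∩ (connEvent ends s y)ᶜ))
    (prob (pinOn (Function.update p e 0) F (fun e' => decide (e' ∈ η))) (connEvent ends s u))
    (prob (pinOn (Function.update p e 0) F (fun e' => decide (e' ∈ η))) (connEvent ends y o ∩ (connEvent ends s y)ᶜ))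
    (prob (pinOn (Function.update p e 0) F (fun e' => decide (e' ∉ η))) (connEvent ends s u ∩ clusterInEvent ends s {W : Set V | o ∈ W} ∩ (connEvent ends s y)ᶜ))
    (prob (pinOn (Function.update p e 0) F (fun e' => decide (e' ∉ η))) (connEvent ends s u ∩ connEvent ends y o ∩ (connEvent ends s y)ᶜ))
    (prob (pinOn (Function.update p e 0) F (fun e' => decide (e' ∉ η))) ((connEvent ends s y)ᶜ))
    (prob (pinOn (Function.update p e 0) F (fun e' => decide (e' ∉ η))) (connEvent ends s u ∩ clusterInEvent ends s {W : Set V | o ∈ W}))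
    (prob (pinOn (Function.update p e 0) F (fun e' => decide (e' ∉ η))) (connEvent ends s u ∩ (connEvent ends s y)ᶜ))
    (prob (pinOn (Function.update p e 0) F (fun e' => decide (e' ∉ η))) (clusterInEvent ends s {W : Set V | o ∈ W}))
    (prob (pinOn (Function.update p e 0) F (fun e' => decide (e' ∉ η))) (clusterInEvent ends s {W : Set V | o ∈ W} ∩ (connEvent ends s y)ᶜ))
    (prob (pinOn (Function.update p e 0) F (fun e' => decide (e' ∉ η))) (connEvent ends s u))
    (prob (pinOn (Function.update p e 0) F (fun e' => decide (e' ∉ η))) (connEvent ends y o ∩ (connEvent ends s y)ᶜ))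
    (prob (pinOn (Function.update p e 1) F (fun e' => decide (e' ∈ η))) (connEvent ends s u ∩ clusterInEvent ends s {W : Set V | o ∈ W} ∩ (connEvent ends s y)ᶜ))
    (prob (pinOn (Function.update p e 1) F (fun e' => decide (e' ∈ η))) (connEvent ends s u ∩ connEvent ends y o ∩ (connEvent ends s y)ᶜ))
    (prob (pinOn (Function.update p e 1) F (fun e' => decide (e' ∈ η))) ((connEvent ends s y)ᶜ))
    (prob (pinOn (Function.update p e 1) F (fun e' => decide (e' ∈ η))) (connEvent ends s u ∩ clusterInEvent ends s {W : Set V | o ∈ W}))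
    (prob (pinOn (Function.update p e 1) F (fun e' => decide (e' ∈ η))) (connEvent ends s u ∩ (connEvent ends s y)ᶜ))
    (prob (pinOn (Function.update p e 1) F (fun e' => decide (e' ∈ η))) (clusterInEvent ends s {W : Set V | o ∈ W}))
    (prob (pinOn (Function.update p e 1) F (fun e' => decide (e' ∈ η))) (clusterInEvent ends s {W : Set V | o ∈ W} ∩ (connEvent ends s y)ᶜ))
    (prob (pinOn (Function.update p e 1) F (fun e' => decide (e' ∈ η))) (connEvent ends s u))
    (prob (pinOn (Function.update p e 1) F (fun e' => decide (e' ∈ η))) (connEvent ends y o ∩ (connEvent ends s y)ᶜ))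
    (prob (pinOn (Function.update p e 1) F (fun e' => decide (e' ∉ η))) (connEvent ends s u ∩ clusterInEvent ends s {W : Set V | o ∈ W} ∩ (connEvent ends s y)ᶜ))
    (prob (pinOn (Function.update p e 1) F (fun e' => decide (e' ∉ η))) (connEvent ends s u ∩ connEvent ends y o ∩ (connEvent ends s y)ᶜ))
    (prob (pinOn (Function.update p e 1) F (fun e' => decide (e' ∉ η))) ((connEvent ends s y)ᶜ))
    (prob (pinOn (Function.update p e 1) F (fun e' => decide (e' ∉ η))) (connEvent ends s u ∩ clusterInEvent ends s {W : Set V | o ∈ W}))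
    (prob (pinOn (Function.update p e 1) F (fun e' => decide (e' ∉ η))) (connEvent ends s u ∩ (connEvent ends s y)ᶜ))
    (prob (pinOn (Function.update p e 1) F (fun e' => decide (e' ∉ η))) (clusterInEvent ends s {W : Set V | o ∈ W}))
    (prob (pinOn (Function.update p e 1) F (fun e' => decide (e' ∉ η))) (clusterInEvent ends s {W : Set V | o ∈ W} ∩ (connEvent ends s y)ᶜ))
    (prob (pinOn (Function.update p e 1) F (fun e' => decide (e' ∉ η))) (connEvent ends s u))
    (prob (pinOn (Function.update p e 1) F (fun e' => decide (e' ∉ η))) (connEvent ends y o ∩ (connEvent ends s y)ᶜ))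
  linear_combination h

/-- **The frame: (R2-1) for every weight vector and every mark assignment ⟸ (TOP-TERM).** -/
theorem r21_of_top_term (ends : E → Sym2 V)
    (hTop : ∀ p : E → R, IsProbVec p → ∀ s y o u : V, ∀ F η : Finset E,
      (∀ f ∈ F, (∃ v ∈ ends f, Conn ends (fun e => decide (p e = 1)) o v) ∧ p f ≠ 0 ∧ p f ≠ 1) → (∀ e, (∃ v ∈ ends e, Conn ends (fun e => decide (p e = 1)) o v) → p e ≠ 0 → p e ≠ 1 → e ∈ F) → η ⊆ F →
      0 ≤ (prob (pinOn p F (fun e' => decide (e' ∈ η))) (connEvent ends s u ∩ clusterInEvent ends s {W : Set V | o ∈ W} ∩ (connEvent ends s y)ᶜ) + prob (pinOn p F (fun e' => decide (e' ∉ η))) (connEvent ends s u ∩ clusterInEvent ends s {W : Set V | o ∈ W} ∩ (connEvent ends s y)ᶜ) + prob (pinOn p F (fun e' => decide (e' ∈ η))) (connEvent ends s u ∩ connEvent ends y o ∩ (connEvent ends s y)ᶜ) + prob (pinOn p F (fun e' => decide (e' ∉ η))) (connEvent ends s u ∩ connEvent ends y o ∩ (connEvent ends s y)ᶜ) + prob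 (pinOn p F (fun e' => decide (e' ∈ η))) ((connEvent ends s y)ᶜ) * prob (pinOn p F (fun e' => decide (e' ∉ η))) (connEvent ends s u ∩ clusterInEvent ends s {W : Set V | o ∈ W}) + prob (pinOn p F (fun e' => decide (e' ∉ η))) ((connEvent ends s y)ᶜ) * prob (pinOn p F (fun e' => decide (e' ∈ η))) (connEvent ends s u ∩ clusterInEvent ends s {W : Set V | o ∈ W}) - (prob (pinOn p F (fun e' => decide (e' ∈ η))) (connEvent ends s u ∩ (connEvent ends s y)ᶜ) * prob (pinOn p F (fun e' => decide (e' ∉ η))) (clusterInEvent ends s {W : Set V | o ∈ W}) + prob (pinOn p F (fun e' => decide (e' ∉ η))) (connEvent ends s u ∩ (connEvent ends s y)ᶜ) * prob (pinOn p F (fun e' => decide (e' ∈ η))) (clusterInEvent ends s {W : Set V | o ∈ W}) + prob (pinOn p F (fun e' => decide (e' ∈ η))) (clusterInEvent ends s {W : Set V | o ∈ W} ∩ (connEvent ends s y)ᶜ) * prob (pinOn p F (fun e' => decide (e' ∉ η))) (connEvent ends s u) + prob (pinOn p F (fun e' => decide (e' ∉ η))) (clusterInEvent ends s {W : Set V |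 o ∈ W} ∩ (connEvent ends s y)ᶜ) * prob (pinOn p F (fun e' => decide (e' ∈ η))) (connEvent ends s u) + prob (pinOn p F (fun e' => decide (e' ∈ η))) (connEvent ends y o ∩ (connEvent ends s y)ᶜ) * prob (pinOn p F (fun e' => decide (e' ∉ η))) (connEvent ends s u) + prob (pinOn p F (fun e' => decide (e' ∉ η))) (connEvent ends y o ∩ (connEvent ends s y)ᶜ) * prob (pinOn p F (fun e' => decide (e' ∈ η))) (connEvent ends s u)))) :
    ∀ p : E → R, IsProbVec p → ∀ s y o u : V, 0 ≤ (prob p (connEvent ends s u ∩ clusterInEvent ends s {W : Set V | o ∈ W} ∩ (connEvent ends s y)ᶜ) + prob p (connEvent ends s u ∩ connEvent ends y o ∩ (connEvent ends s y)ᶜ) + prob p ((connEvent ends s y)ᶜ) * prob p (connEvent ends s u ∩ clusterInEvent ends s {W : Set V | o ∈ W}) - (prob p (connEvent ends s u ∩ (connEvent ends s y)ᶜ) * prob p (clusterInEvent ends s {W : Set V | o ∈ W}) + prob p (clusterInEvent ends s {W : Set V | o ∈ W} ∩ (connEvent ends s y)ᶜ) * prob p (connEvent ends s u) + prob p (connEvent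 ends y o ∩ (connEvent ends s y)ᶜ) * prob p (connEvent ends s u))) := by
  classical
  suffices hΦ : ∀ p : E → R, IsProbVec p → (fun q : E → R => ∀ s y o u : V, ∀ F η : Finset E, (∀ f ∈ F, (∃ v ∈ ends f, Conn ends (fun e => decide (q e = 1)) o v) ∧ q f ≠ 0 ∧ q f ≠ 1) → η ⊆ F → 0 ≤ (prob (pinOn q F (fun e' => decide (e' ∈ η))) (connEvent ends s u ∩ clusterInEvent ends s {W : Set V | o ∈ W} ∩ (connEvent ends s y)ᶜ) + prob (pinOn q F (fun e' => decide (e' ∉ η))) (connEvent ends s u ∩ clusterInEvent ends s {W : Set V | o ∈ W} ∩ (connEvent ends s y)ᶜ) + prob (pinOn q F (fun e' => decide (e' ∈ η))) (connEvent ends s u ∩ connEvent ends y o ∩ (connEvent ends s y)ᶜ) + prob (pinOn q F (fun e' => decide (e' ∉ η))) (connEvent ends s u ∩ connEvent ends y o ∩ (connEvent ends s y)ᶜ) + prob (pinOn q F (fun e' => decide (e' ∈ η))) ((connEvent ends s y)ᶜ) * prob (pinOn q F (fun e' => decide (e' ∉ η))) (connEvent ends s u ∩ clusterInEvent ends s {W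 : Set V | o ∈ W}) + prob (pinOn q F (fun e' => decide (e' ∉ η))) ((connEvent ends s y)ᶜ) * prob (pinOn q F (fun e' => decide (e' ∈ η))) (connEvent ends s u ∩ clusterInEvent ends s {W : Set V | o ∈ W}) - (prob (pinOn q F (fun e' => decide (e' ∈ η))) (connEvent ends s u ∩ (connEvent ends s y)ᶜ) * prob (pinOn q F (fun e' => decide (e' ∉ η))) (clusterInEvent ends s {W : Set V | o ∈ W}) + prob (pinOn q F (fun e' => decide (e' ∉ η))) (connEvent ends s u ∩ (connEvent ends s y)ᶜ) * prob (pinOn q F (fun e' => decide (e' ∈ η))) (clusterInEvent ends s {W : Set V | o ∈ W}) + prob (pinOn q F (fun e' => decide (e' ∈ η))) (clusterInEvent ends s {W : Set V | o ∈ W} ∩ (connEvent ends s y)ᶜ) * prob (pinOn q F (fun e' => decide (e' ∉ η))) (connEvent ends s u) + prob (pinOn q F (fun e' => decide (e' ∉ η))) (clusterInEvent ends s {W : Set V | o ∈ W} ∩ (connEvent ends s y)ᶜ) * prob (pinOn q F (fun e' => decide (e' ∈ η))) (connEvent ends s u) + prob (pinOn q F (fun e' => decide (e' ∈ η))) (connEvent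 ends y o ∩ (connEvent ends s y)ᶜ) * prob (pinOn q F (fun e' => decide (e' ∉ η))) (connEvent ends s u) + prob (pinOn q F (fun e' => decide (e' ∉ η))) (connEvent ends y o ∩ (connEvent ends s y)ᶜ) * prob (pinOn q F (fun e' => decide (e' ∈ η))) (connEvent ends s u)))) p by
    intro p hp s y o u
    have h := hΦ p hp s y o u ∅ ∅ (by simp) (Finset.Subset.refl _)
    rw [pinOn_empty', pinOn_empty'] at h
    linarith
  refine pin_strong_induction _ fun p hp ih => ?_
  intro s y o u
  have key : ∀ n : ℕ, ∀ F η : Finset E, (∀ f ∈ F, (∃ v ∈ ends f, Conn ends (fun e => decide (p e = 1)) o v) ∧ p f ≠ 0 ∧ p f ≠ 1) → η ⊆ F →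
      (Finset.univ.filter fun e => e ∉ F ∧ (∃ v ∈ ends e, Conn ends (fun e => decide (p e = 1)) o v) ∧ p e ≠ 0 ∧ p e ≠ 1).card = n →
      0 ≤ (prob (pinOn p F (fun e' => decide (e' ∈ η))) (connEvent ends s u ∩ clusterInEvent ends s {W : Set V | o ∈ W} ∩ (connEvent ends s y)ᶜ) + prob (pinOn p F (fun e' => decide (e' ∉ η))) (connEvent ends s u ∩ clusterInEvent ends s {W : Set V | o ∈ W} ∩ (connEvent ends s y)ᶜ) + prob (pinOn p F (fun e' => decide (e' ∈ η))) (connEvent ends s u ∩ connEvent ends y o ∩ (connEvent ends s y)ᶜ) + prob (pinOn p F (fun e' => decide (e' ∉ η))) (connEvent ends s u ∩ connEvent ends y o ∩ (connEvent ends s y)ᶜ) + prob (pinOn p F (fun e' => decide (e' ∈ η))) ((connEvent ends s y)ᶜ) * prob (pinOn p F (fun e' => decide (e' ∉ η))) (connEvent ends s u ∩ clusterInEvent ends s {W : Set V | o ∈ W}) + prob (pinOn p F (fun e' => decide (e' ∉ η))) ((connEvent ends s y)ᶜ) * prob (pinOn p F (fun e' => decide (e' ∈ η))) (connEvent ends s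 u ∩ clusterInEvent ends s {W : Set V | o ∈ W}) - (prob (pinOn p F (fun e' => decide (e' ∈ η))) (connEvent ends s u ∩ (connEvent ends s y)ᶜ) * prob (pinOn p F (fun e' => decide (e' ∉ η))) (clusterInEvent ends s {W : Set V | o ∈ W}) + prob (pinOn p F (fun e' => decide (e' ∉ η))) (connEvent ends s u ∩ (connEvent ends s y)ᶜ) * prob (pinOn p F (fun e' => decide (e' ∈ η))) (clusterInEvent ends s {W : Set V | o ∈ W}) + prob (pinOn p F (fun e' => decide (e' ∈ η))) (clusterInEvent ends s {W : Set V | o ∈ W} ∩ (connEvent ends s y)ᶜ) * prob (pinOn p F (fun e' => decide (e' ∉ η))) (connEvent ends s u) + prob (pinOn p F (fun e' => decide (e' ∉ η))) (clusterInEvent ends s {W : Set V | o ∈ W} ∩ (connEvent ends s y)ᶜ) * prob (pinOn p F (fun e' => decide (e' ∈ η))) (connEvent ends s u) + prob (pinOn p F (fun e' => decide (e' ∈ η))) (connEvent ends y o ∩ (connEvent ends s y)ᶜ) * prob (pinOn p F (fun e' => decide (e' ∉ η))) (connEvent ends s u) + prob (pinOn p F (fun e' => decide (e' ∉ η))) (connEvent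 ends y o ∩ (connEvent ends s y)ᶜ) * prob (pinOn p F (fun e' => decide (e' ∈ η))) (connEvent ends s u))) := by
    intro n
    induction n using Nat.strong_induction_on with
    | _ n ihn =>
      intro F η hF hη hcard
      by_cases hfull : (∀ e, (∃ v ∈ ends e, Conn ends (fun e => decide (p e = 1)) o v) → p e ≠ 0 → p e ≠ 1 → e ∈ F)
      · exact hTop p hp s y o u F η hF hfull hη
      · rw [not_forall] at hfull
        obtain ⟨e, he⟩ := hfull
        rw [Classical.not_imp, Classical.not_imp, Classical.not_imp] at he
        obtain ⟨heΛ, he0, he1, heF⟩ := he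
        have heη : e ∉ η := fun h => heF (hη h)
        rw [r21_term_eq_bernstein p ends s y o u F η e heF]
        have hA : 0 ≤ (prob (pinOn (Function.update p e 0) F (fun e' => decide (e' ∈ η))) (connEvent ends s u ∩ clusterInEvent ends s {W : Set V | o ∈ W} ∩ (connEvent ends s y)ᶜ) + prob (pinOn (Function.update p e 0) F (fun e' => decide (e' ∉ η))) (connEvent ends s u ∩ clusterInEvent ends s {W : Set V | o ∈ W} ∩ (connEvent ends s y)ᶜ) + prob (pinOn (Function.update p e 0) F (fun e' => decide (e' ∈ η))) (connEvent ends s u ∩ connEvent ends y o ∩ (connEvent ends s y)ᶜ) + prob (pinOn (Function.update p e 0) F (fun e' => decide (e' ∉ η))) (connEvent ends s u ∩ connEvent ends y o ∩ (connEvent ends s y)ᶜ) + prob (pinOn (Function.update p e 0) F (fun e' => decide (e' ∈ η))) ((connEvent ends s y)ᶜ) * prob (pinOn (Function.update p e 0) F (fun e' => decide (e' ∉ η))) (connEvent ends s u ∩ clusterInEvent ends s {W : Set V | o ∈ W}) + prob (pinOn (Function.update p e 0) F (fun e' => decide (e' ∉ η))) ((connEvent ends s y)ᶜ) * prob (pinOn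 (Function.update p e 0) F (fun e' => decide (e' ∈ η))) (connEvent ends s u ∩ clusterInEvent ends s {W : Set V | o ∈ W}) - (prob (pinOn (Function.update p e 0) F (fun e' => decide (e' ∈ η))) (connEvent ends s u ∩ (connEvent ends s y)ᶜ) * prob (pinOn (Function.update p e 0) F (fun e' => decide (e' ∉ η))) (clusterInEvent ends s {W : Set V | o ∈ W}) + prob (pinOn (Function.update p e 0) F (fun e' => decide (e' ∉ η))) (connEvent ends s u ∩ (connEvent ends s y)ᶜ) * prob (pinOn (Function.update p e 0) F (fun e' => decide (e' ∈ η))) (clusterInEvent ends s {W : Set V | o ∈ W}) + prob (pinOn (Function.update p e 0) F (fun e' => decide (e' ∈ η))) (clusterInEvent ends s {W : Set V | o ∈ W} ∩ (connEvent ends s y)ᶜ) * prob (pinOn (Function.update p e 0) F (fun e' => decide (e' ∉ η))) (connEvent ends s u) + prob (pinOn (Function.update p e 0) F (fun e' => decide (e' ∉ η))) (clusterInEvent ends s {W : Set V | o ∈ W} ∩ (connEvent ends s y)ᶜ) * prob (pinOn (Function.update p e 0) F (fun e' => decide (e' ∈ η))) (connEvent ends s u) + prob (pinOn (Function.update p e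 0) F (fun e' => decide (e' ∈ η))) (connEvent ends y o ∩ (connEvent ends s y)ᶜ) * prob (pinOn (Function.update p e 0) F (fun e' => decide (e' ∉ η))) (connEvent ends s u) + prob (pinOn (Function.update p e 0) F (fun e' => decide (e' ∉ η))) (connEvent ends y o ∩ (connEvent ends s y)ᶜ) * prob (pinOn (Function.update p e 0) F (fun e' => decide (e' ∈ η))) (connEvent ends s u))) := by
          refine ih (Function.update p e 0) (hp.update e le_rfl zero_le_one)
            (card_unpinned_update_lt p e he0 he1 0 (Or.inl rfl)) s y o u F η (fun f hf => ?_) hη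
          obtain ⟨hfΛ, hf0, hf1⟩ := hF f hf
          have hfe : f ≠ e := fun h => heF (h ▸ hf)
          rw [pinned_update_zero_eq p e he1]
          exact ⟨hfΛ, by rw [Function.update_of_ne hfe]; exact hf0, by rw [Function.update_of_ne hfe]; exact hf1⟩
        have hB : 0 ≤ (prob (pinOn (Function.update p e 1) F (fun e' => decide (e' ∈ η))) (connEvent ends s u ∩ clusterInEvent ends s {W : Set V | o ∈ W} ∩ (connEvent ends s y)ᶜ) + prob (pinOn (Function.update p e 1) F (fun e' => decide (e' ∉ η))) (connEvent ends s u ∩ clusterInEvent ends s {W : Set V | o ∈ W} ∩ (connEvent ends s y)ᶜ) + prob (pinOn (Function.update p e 1) F (fun e' => decide (e' ∈ η))) (connEvent ends s u ∩ connEvent ends y o ∩ (connEvent ends s y)ᶜ) + prob (pinOn (Function.update p e 1) F (fun e' => decide (e' ∉ η))) (connEvent ends s u ∩ connEvent ends y o ∩ (connEvent ends s y)ᶜ) + prob (pinOn (Function.update p e 1) F (fun e' => decide (e' ∈ η))) ((connEvent ends s y)ᶜ) * prob (pinOn (Function.update p e 1) F (fun e' => decide (e' ∉ η))) (connEvent ends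 s u ∩ clusterInEvent ends s {W : Set V | o ∈ W}) + prob (pinOn (Function.update p e 1) F (fun e' => decide (e' ∉ η))) ((connEvent ends s y)ᶜ) * prob (pinOn (Function.update p e 1) F (fun e' => decide (e' ∈ η))) (connEvent ends s u ∩ clusterInEvent ends s {W : Set V | o ∈ W}) - (prob (pinOn (Function.update p e 1) F (fun e' => decide (e' ∈ η))) (connEvent ends s u ∩ (connEvent ends s y)ᶜ) * prob (pinOn (Function.update p e 1) F (fun e' => decide (e' ∉ η))) (clusterInEvent ends s {W : Set V | o ∈ W}) + prob (pinOn (Function.update p e 1) F (fun e' => decide (e' ∉ η))) (connEvent ends s u ∩ (connEvent ends s y)ᶜ) * prob (pinOn (Function.update p e 1) F (fun e' => decide (e' ∈ η))) (clusterInEvent ends s {W : Set V | o ∈ W}) + prob (pinOn (Function.update p e 1) F (fun e' => decide (e' ∈ η))) (clusterInEvent ends s {W : Set V | o ∈ W} ∩ (connEvent ends s y)ᶜ) * prob (pinOn (Function.update p e 1) F (fun e' => decide (e' ∉ η))) (connEvent ends s u) + prob (pinOn (Function.update p e 1) F (fun e' => decide (e' ∉ η))) (clusterInEvent ends s {W :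 Set V | o ∈ W} ∩ (connEvent ends s y)ᶜ) * prob (pinOn (Function.update p e 1) F (fun e' => decide (e' ∈ η))) (connEvent ends s u) + prob (pinOn (Function.update p e 1) F (fun e' => decide (e' ∈ η))) (connEvent ends y o ∩ (connEvent ends s y)ᶜ) * prob (pinOn (Function.update p e 1) F (fun e' => decide (e' ∉ η))) (connEvent ends s u) + prob (pinOn (Function.update p e 1) F (fun e' => decide (e' ∉ η))) (connEvent ends y o ∩ (connEvent ends s y)ᶜ) * prob (pinOn (Function.update p e 1) F (fun e' => decide (e' ∈ η))) (connEvent ends s u))) := by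
          refine ih (Function.update p e 1) (hp.update e zero_le_one le_rfl)
            (card_unpinned_update_lt p e he0 he1 1 (Or.inr rfl)) s y o u F η (fun f hf => ?_) hη
          obtain ⟨⟨v, hv, hvΛ⟩, hf0, hf1⟩ := hF f hf
          have hfe : f ≠ e := fun h => heF (h ▸ hf)
          exact ⟨⟨v, hv, conn_mono (pinned_le_update_one p e) hvΛ⟩, by rw [Function.update_of_ne hfe]; exact hf0,
            by rw [Function.update_of_ne hfe]; exact hf1⟩
        have hcard' : (Finset.univ.filter fun e' => e' ∉ insert e F ∧ (∃ v ∈ ends e', Conn ends (fun e => decide (p e = 1)) o v) ∧ p e' ≠ 0 ∧ p e' ≠ 1).card < n := by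
          rw [← hcard]
          refine Finset.card_lt_card ⟨fun x hx => ?_, fun hsub => ?_⟩
          · simp only [Finset.mem_filter, Finset.mem_univ, true_and, Finset.mem_insert, not_or] at hx ⊢
            exact ⟨hx.1.2, hx.2⟩
          · have := hsub (by simp [heF, heΛ, he0, he1] : e ∈ (Finset.univ.filter fun e' => e' ∉ F ∧ (∃ v ∈ ends e', Conn ends (fun e => decide (p e = 1)) o v) ∧ p e' ≠ 0 ∧ p e' ≠ 1))
            simp at this
        have hF' : (∀ f ∈ (insert e F), (∃ v ∈ ends f, Conn ends (fun e => decide (p e = 1)) o v) ∧ p f ≠ 0 ∧ p f ≠ 1) := by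
          intro f hf
          rw [Finset.mem_insert] at hf
          rcases hf with rfl | hf
          · exact ⟨heΛ, he0, he1⟩
          · exact hF f hf
        have hC : 0 ≤ (prob (pinOn (Function.update p e 0) F (fun e' => decide (e' ∈ η))) (connEvent ends s u ∩ clusterInEvent ends s {W : Set V | o ∈ W} ∩ (connEvent ends s y)ᶜ) + prob (pinOn (Function.update p e 1) F (fun e' => decide (e' ∉ η))) (connEvent ends s u ∩ clusterInEvent ends s {W : Set V | o ∈ W} ∩ (connEvent ends s y)ᶜ) + prob (pinOn (Function.update p e 0) F (fun e' => decide (e' ∈ η))) (connEvent ends s u ∩ connEvent ends y o ∩ (connEvent ends s y)ᶜ) + prob (pinOn (Function.update p e 1) F (fun e' => decide (e' ∉ η))) (connEvent ends s u ∩ connEvent ends y o ∩ (connEvent ends s y)ᶜ) + prob (pinOn (Function.update p e 0) F (fun e' => decide (e' ∈ η))) ((connEvent ends s y)ᶜ) * prob (pinOn (Function.update p e 1) F (fun e' => decide (e' ∉ η))) (connEvent ends s u ∩ clusterInEvent ends s {W : Set V | o ∈ W}) + prob (pinOn (Function.update p e 1) F (fun e' => decide (e' ∉ η))) ((connEvent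 ends s y)ᶜ) * prob (pinOn (Function.update p e 0) F (fun e' => decide (e' ∈ η))) (connEvent ends s u ∩ clusterInEvent ends s {W : Set V | o ∈ W}) - (prob (pinOn (Function.update p e 0) F (fun e' => decide (e' ∈ η))) (connEvent ends s u ∩ (connEvent ends s y)ᶜ) * prob (pinOn (Function.update p e 1) F (fun e' => decide (e' ∉ η))) (clusterInEvent ends s {W : Set V | o ∈ W}) + prob (pinOn (Function.update p e 1) F (fun e' => decide (e' ∉ η))) (connEvent ends s u ∩ (connEvent ends s y)ᶜ) * prob (pinOn (Function.update p e 0) F (fun e' => decide (e' ∈ η))) (clusterInEvent ends s {W : Set V | o ∈ W}) + prob (pinOn (Function.update p e 0) F (fun e' => decide (e' ∈ η))) (clusterInEvent ends s {W : Set V | o ∈ W} ∩ (connEvent ends s y)ᶜ) * prob (pinOn (Function.update p e 1) F (fun e' => decide (e' ∉ η))) (connEvent ends s u) + prob (pinOn (Function.update p e 1) F (fun e' => decide (e' ∉ η))) (clusterInEvent ends s {W : Set V | o ∈ W} ∩ (connEvent ends s y)ᶜ) * prob (pinOn (Function.update p e 0) F (fun e' => decide (e' ∈ η))) (connEvent ends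 s u) + prob (pinOn (Function.update p e 0) F (fun e' => decide (e' ∈ η))) (connEvent ends y o ∩ (connEvent ends s y)ᶜ) * prob (pinOn (Function.update p e 1) F (fun e' => decide (e' ∉ η))) (connEvent ends s u) + prob (pinOn (Function.update p e 1) F (fun e' => decide (e' ∉ η))) (connEvent ends y o ∩ (connEvent ends s y)ᶜ) * prob (pinOn (Function.update p e 0) F (fun e' => decide (e' ∈ η))) (connEvent ends s u))) := by
          rw [← pinOn_insert_mem_zero p F η heF heη, ← pinOn_insert_notMem_one p F η heF heη]
          exact ihn _ hcard' (insert e F) η hF' (hη.trans (Finset.subset_insert e F)) rfl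
        have hD : 0 ≤ (prob (pinOn (Function.update p e 1) F (fun e' => decide (e' ∈ η))) (connEvent ends s u ∩ clusterInEvent ends s {W : Set V | o ∈ W} ∩ (connEvent ends s y)ᶜ) + prob (pinOn (Function.update p e 0) F (fun e' => decide (e' ∉ η))) (connEvent ends s u ∩ clusterInEvent ends s {W : Set V | o ∈ W} ∩ (connEvent ends s y)ᶜ) + prob (pinOn (Function.update p e 1) F (fun e' => decide (e' ∈ η))) (connEvent ends s u ∩ connEvent ends y o ∩ (connEvent ends s y)ᶜ) + prob (pinOn (Function.update p e 0) F (fun e' => decide (e' ∉ η))) (connEvent ends s u ∩ connEvent ends y o ∩ (connEvent ends s y)ᶜ) + prob (pinOn (Function.update p e 1) F (fun e' => decide (e' ∈ η))) ((connEvent ends s y)ᶜ) * prob (pinOn (Function.update p e 0) F (fun e' => decide (e' ∉ η))) (connEvent ends s u ∩ clusterInEvent ends s {W : Set V | o ∈ W}) + prob (pinOn (Function.update p e 0) F (fun e' => decide (e' ∉ η))) ((connEvent ends s y)ᶜ) * prob (pinOn (Function.update p e 1) F (fun e' => decide (e' ∈ η))) (connEvent ends s u ∩ clusterInEvent ends s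 {W : Set V | o ∈ W}) - (prob (pinOn (Function.update p e 1) F (fun e' => decide (e' ∈ η))) (connEvent ends s u ∩ (connEvent ends s y)ᶜ) * prob (pinOn (Function.update p e 0) F (fun e' => decide (e' ∉ η))) (clusterInEvent ends s {W : Set V | o ∈ W}) + prob (pinOn (Function.update p e 0) F (fun e' => decide (e' ∉ η))) (connEvent ends s u ∩ (connEvent ends s y)ᶜ) * prob (pinOn (Function.update p e 1) F (fun e' => decide (e' ∈ η))) (clusterInEvent ends s {W : Set V | o ∈ W}) + prob (pinOn (Function.update p e 1) F (fun e' => decide (e' ∈ η))) (clusterInEvent ends s {W : Set V | o ∈ W} ∩ (connEvent ends s y)ᶜ) * prob (pinOn (Function.update p e 0) F (fun e' => decide (e' ∉ η))) (connEvent ends s u) + prob (pinOn (Function.update p e 0) F (fun e' => decide (e' ∉ η))) (clusterInEvent ends s {W : Set V | o ∈ W} ∩ (connEvent ends s y)ᶜ) * prob (pinOn (Function.update p e 1) F (fun e' => decide (e' ∈ η))) (connEvent ends s u) + prob (pinOn (Function.update p e 1) F (fun e' => decide (e' ∈ η))) (connEvent ends y o ∩ (connEvent ends s y)ᶜ) *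 prob (pinOn (Function.update p e 0) F (fun e' => decide (e' ∉ η))) (connEvent ends s u) + prob (pinOn (Function.update p e 0) F (fun e' => decide (e' ∉ η))) (connEvent ends y o ∩ (connEvent ends s y)ᶜ) * prob (pinOn (Function.update p e 1) F (fun e' => decide (e' ∈ η))) (connEvent ends s u))) := by
          rw [← pinOn_insert_mem_one p F η heF, ← pinOn_insert_notMem_zero p F η heF]
          exact ihn _ hcard' (insert e F) (insert e η) hF' (Finset.insert_subset_insert e hη) rfl
        have hw0 := hp.nonneg e
        have hw1 := hp.le_one e
        have hw' : 0 ≤ 1 - p e := by linarith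
        have e1 : 0 ≤ (1 - p e) ^ 2 * _ := mul_nonneg (by positivity) hA
        have e2 : 0 ≤ p e ^ 2 * _ := mul_nonneg (by positivity) hB
        have e3 : 0 ≤ p e * (1 - p e) * (_ + _) := mul_nonneg (mul_nonneg hw0 hw') (add_nonneg hC hD)
        linarith
  intro F η hF hη
  exact key _ F η hF hη rfl


end TermFrame

end Summit.Ventures.PercRepro2
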